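import Summits.QuantumFields.YangMills.Theorems.UnitScaleTiltFluctuationComparisonRegPrGlobalSlackKernelLegCfgFixedPoint
import HarnessLib

/-!
# `UnitScaleTiltFluctuationComparisonRegPrGlobalSlackKernelLegCfgFixedPointFine` — THE FIXED POINT EXISTS IN THE (44)-BOX, AND THE LOOP-VARIABLE ROWS OF 3⁗χ FROM ONE
# FINE-LEVEL TWO-CUT-OFF COMPARISON (crux `FluctuationComparisonRegPrIntL`, stmt-QuantumFields-20520, skeleton v5kC, STUB 3⁗χ `stub_globalTwoRunSlackFamChi`; cell `pub/ym-inputs`,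
# seat ym-inputs-p12 = INPUT-LIST I-11 row `CfgDistCauchyΦ`; count-neutral helper, registry untouched)

Two complements to `…KernelLegCfgFixedPoint` / `…CfgFixedPointChi` / `…CfgFixedPointTwoRun` (same seat), both def-free with every object a FREE variable:

* §1 **`exists_isFixedPt_of_weighted_contraction`** — Banach's theorem in the legwise weighted sup currency of those files: on a finite bond set with positive weights `w`, a map
  `T` that sends the box `{x | ∀ c, ‖x c‖ ≤ ρ c}` into itself and is legwise `w`-weighted `q`-Lipschitz on it (`0 ≤ q < 1`) has a UNIQUE fixed point in the box as soon as the
  box has a point (values in a complete normed group; Picard iteration, `cauchySeq_of_le_geometric`, uniqueness by `norm_sub_le_weighted_of_isFixedPt` with zero defect).  This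
  is what a DEFINER of the loop variables needs to read display (F) «`B` is the fixed point of run `K`'s map» as a definition ([Balaban1985Variational]'s successive
  approximations on the small-field ball = the (44)-box).
* §2 **`cfgRefOwnΦ_of_fineComparison`**, **`cfgDistCauchyΦ_of_fineComparison`** — THE LOCATED SHAPE OF THE SUPPLIER'S ROUTE.  The loop variables at chart level `j` are a
  function `Φ K k j Y` of run `K`'s FINE background `U K k W ∈ S K` (for the minimiser: `j`-fold averaging + the (27) axial logarithms, [Balaban1985UV3] (27) p.263, (43)–(44)
  pp.266–267); run `K+1`'s level-`(j+1)` loop variables on the matched bonds are the SAME map read at the once-averaged run-`(K+1)` background `Ū ∈ S K` (averaging `j+1`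
  times = once, then `j` times); so BOTH loop-variable rows follow from ONE comparison at the finest level — `δ(U_K, Ū_{K+1}) ≤ C_f·θ(n)·(L^{−(K−n)})^a` (two cut-offs) or
  `δ(U_K, U_ref) ≤ …` (reference) — pushed through the legwise Lipschitz bound `‖Φ(s) c − Φ(s′) c‖ ≤ L_Φ·(1+d(c))·x²·δ(s,s′)`, the chart-level rate `(L^{−(1+j)})^a` being WEAKER
  than the depth rate `(L^{−(K−n)})^a` because `1 + j ≤ K − n` ([King1986]'s pointwise rate `L^{−γk}`, `k` = number of steps below the unit lattice, Prop. 3.8 (3.71)).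
  `S`, `U`, `Ū`/`U_ref`, `Φ`, `δ` are free; no `LocMatched` / `DistMatched` / reference coherence is used by the two-run form.
HONEST FRAMING.  §1 is folklore analysis; §2 is bookkeeping that records WHERE the one analytic input sits (the fine-level two-cut-off comparison of constrained minimisers,
located-UNPRINTED for the non-abelian d = 3 model; [King1986] Props 3.8–3.10 are the flat U(1) template).  Nothing of [Balaban1985UV3] / [Balaban1985Variational] / [King1986]
is asserted; no summit / rung / gap claim (YM₃ on T³ is rung R3, not the Clay problem).

References: C. King, CMP 102 (1986) 649–677 [King1986] (Prop. 3.8 (3.71) p.664, Prop. 3.9 (3.73)–(3.74) p.665, Prop. 3.10 (3.91) p.669); T. Bałaban, CMP 102 (1985) 255–275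
[Balaban1985UV3] ((27) p.263, (43)–(45) pp.266–267); CMP 102 (1985) 277–309 [Balaban1985Variational] (Thm 1 (8) p.279); CMP 98 (1985) 17–51 [Balaban1985Averaging] (Prop. 2 p.26);
CMP 109 (1987) 249–301 [Balaban1987RG1] ((0.1) p.251).
-/

set_option autoImplicit false

noncomputable section

open scoped BigOperators
open Finset Filter Topology
open Literature.MathematicalPhysics.QuantumFieldTheory.Balaban1983to89
open Literature.MathematicalPhysics.QuantumFieldTheory.Balaban1983to89.T3ContinuumYM3Torus
open Literature.MathematicalPhysics.QuantumFieldTheory.Balaban1983to89.T3UnitScaleTilt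
open Literature.MathematicalPhysics.QuantumFieldTheory.Balaban1983to89.T3LevelShift
open Literature.MathematicalPhysics.QuantumFieldTheory.Balaban1983to89.T3AlphaInputsAC
open Literature.MathematicalPhysics.QuantumFieldTheory.Balaban1983to89.T3AlphaPolymerSocket
open Literature.MathematicalPhysics.QuantumFieldTheory.Balaban1983to89.T3AlphaInputsACTwoRun
open Literature.MathematicalPhysics.QuantumFieldTheory.Balaban1983to89.T3AlphaInputsACTwoRunLevel
open Literature.MathematicalPhysics.QuantumFieldTheory.Balaban1985CMP102
open Literature.MathematicalPhysics.QuantumFieldTheory.Balaban1985CMP102.Setting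
open Summit.QuantumFields.Balaban3D.Carriers
open Summit.QuantumFields.Balaban3D.Proofs.Primitives
open Summit.QuantumFields.Balaban3D.Proofs.GroupModelLieC (lieC)
open Summit.QuantumFields.YangMills.Theorems
open Summit.QuantumFields.YangMills.Theorems.GlobalSlackKernelMatching
open Summit.QuantumFields.YangMills.Theorems.GlobalSlackCanonicalPolymers

namespace Summit.QuantumFields.YangMills.Theorems.GlobalSlackKernelLeg

/-! ## §1 Existence and uniqueness of the fixed point in a weighted box -/

section Exists

variable {ι : Type*} [Fintype ι] {E : Type*} [NormedAddCommGroup E] [CompleteSpace E]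

/-- **EXISTENCE AND UNIQUENESS OF THE FIXED POINT IN A WEIGHTED BOX** (Banach's fixed-point theorem in the legwise weighted sup currency of
`norm_sub_le_weighted_of_isFixedPt`; [Balaban1985Variational]'s successive approximations): on a finite index set with positive weights `w`, if `T` maps the box
`{x | ∀ c, ‖x c‖ ≤ ρ c}` into itself, is legwise `w`-weighted `q`-Lipschitz on it with `0 ≤ q < 1`, and the box contains a point `x₀`, then `T` has a unique fixed point in
the box (values in a complete normed group). [folklore] -/
theorem exists_isFixedPt_of_weighted_contraction (w : ι → ℝ) (hw : ∀ c, 0 < w c) (ρ : ι → ℝ) (T : (ι → E) → (ι → E)) {q : ℝ} (hq0 : 0 ≤ q) (hq1 : q < 1)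
    (x₀ : ι → E) (hx₀ : ∀ c, ‖x₀ c‖ ≤ ρ c)
    (hmaps : ∀ x : ι → E, (∀ c, ‖x c‖ ≤ ρ c) → ∀ c, ‖T x c‖ ≤ ρ c)
    (hlip : ∀ x y : ι → E, (∀ c, ‖x c‖ ≤ ρ c) → (∀ c, ‖y c‖ ≤ ρ c) →
      ∀ M : ℝ, 0 ≤ M → (∀ c, ‖x c - y c‖ ≤ M * w c) → ∀ c, ‖T x c - T y c‖ ≤ q * M * w c) :
    ∃ x : ι → E, (∀ c, ‖x c‖ ≤ ρ c) ∧ T x = x ∧ ∀ y : ι → E, (∀ c, ‖y c‖ ≤ ρ c) → T y = y → y = x := by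
  classical
  -- uniqueness from the a-posteriori bound with zero defect
  have huniq : ∀ x : ι → E, (∀ c, ‖x c‖ ≤ ρ c) → T x = x → ∀ y : ι → E, (∀ c, ‖y c‖ ≤ ρ c) → T y = y → y = x := by
    intro x hx hTx y hy hTy
    have h := norm_sub_le_weighted_of_isFixedPt w hw T (δ := 0) hq1 y x hTy
      (fun M hM hM' => hlip y x hy hx M hM hM') (fun c => by rw [hTx, sub_self, norm_zero, zero_mul])
    funext c
    have hc := h c
    rw [zero_div, zero_mul] at hc
    exact sub_eq_zero.mp (norm_le_zero_iff.mp hc)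
  rcases isEmpty_or_nonempty ι with hι | hι
  · exact ⟨x₀, hx₀, Subsingleton.elim _ _, fun y _ _ => Subsingleton.elim _ _⟩
  -- the extreme weights
  obtain ⟨c₁⟩ := hι
  set m : ℝ := Finset.univ.inf' ⟨c₁, Finset.mem_univ _⟩ w with hm
  set Wm : ℝ := Finset.univ.sup' ⟨c₁, Finset.mem_univ _⟩ w with hWm
  have hm0 : 0 < m := (Finset.lt_inf'_iff _).2 fun c _ => hw c
  have hmle : ∀ c, m ≤ w c := fun c => Finset.inf'_le _ (Finset.mem_univ c)
  have hleW : ∀ c, w c ≤ Wm := fun c => Finset.le_sup' _ (Finset.mem_univ c)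
  have hW0 : 0 < Wm := (hw c₁).trans_le (hleW c₁)
  -- sup norm ↔ weighted legwise bounds
  have toW : ∀ f : ι → E, ∀ c, ‖f c‖ ≤ ‖f‖ / m * w c := fun f c => by
    calc ‖f c‖ ≤ ‖f‖ := norm_le_pi_norm f c
      _ = ‖f‖ / m * m := by rw [div_mul_cancel₀ _ hm0.ne']
      _ ≤ ‖f‖ / m * w c := mul_le_mul_of_nonneg_left (hmle c) (div_nonneg (norm_nonneg _) hm0.le)
  have fromW : ∀ f : ι → E, ∀ M : ℝ, 0 ≤ M → (∀ c, ‖f c‖ ≤ M * w c) → ‖f‖ ≤ M * Wm := fun f M hM hf =>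
    (pi_norm_le_iff_of_nonneg (mul_nonneg hM hW0.le)).2 fun c => (hf c).trans (mul_le_mul_of_nonneg_left (hleW c) hM)
  -- the Picard iterates stay in the box
  set u : ℕ → (ι → E) := fun n => T^[n] x₀ with hu
  have hu_succ : ∀ n, u (n + 1) = T (u n) := fun n => Function.iterate_succ_apply' T n x₀
  have hbox : ∀ n c, ‖u n c‖ ≤ ρ c := by
    intro n
    induction n with
    | zero => simpa [hu] using hx₀
    | succ n ih => rw [hu_succ]; exact hmaps _ ih
  -- weighted geometric decay of the increments
  set M₀ : ℝ := ‖u 1 - u 0‖ / m with hM₀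
  have hM₀0 : 0 ≤ M₀ := div_nonneg (norm_nonneg _) hm0.le
  have hstep : ∀ n c, ‖u (n + 1) c - u n c‖ ≤ M₀ * q ^ n * w c := by
    intro n
    induction n with
    | zero =>
      intro c
      have h := toW (u 1 - u 0) c
      rw [Pi.sub_apply] at h
      simpa [hM₀] using h
    | succ n ih =>
      intro c
      have e1 : u (n + 1 + 1) c = T (u (n + 1)) c := by rw [hu_succ (n + 1)]
      have e2 : u (n + 1) c = T (u n) c := by rw [hu_succ n]
      rw [e1, e2]
      have h := hlip (u (n + 1)) (u n) (hbox _) (hbox _) (M₀ * q ^ n) (by positivity) ih c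
      calc ‖T (u (n + 1)) c - T (u n) c‖ ≤ q * (M₀ * q ^ n) * w c := h
        _ = M₀ * q ^ (n + 1) * w c := by ring
  have hdist : ∀ n, dist (u n) (u (n + 1)) ≤ M₀ * Wm * q ^ n := fun n => by
    rw [dist_comm, dist_eq_norm]
    have h := fromW (u (n + 1) - u n) (M₀ * q ^ n) (by positivity) fun c => by rw [Pi.sub_apply]; exact hstep n c
    calc ‖u (n + 1) - u n‖ ≤ M₀ * q ^ n * Wm := h
      _ = M₀ * Wm * q ^ n := by ring
  obtain ⟨x, hx⟩ := cauchySeq_tendsto_of_complete (cauchySeq_of_le_geometric q (M₀ * Wm) hq1 hdist)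
  -- the limit lies in the (closed) box
  have hxbox : ∀ c, ‖x c‖ ≤ ρ c := fun c => by
    have hcont : Continuous fun f : ι → E => ‖f c‖ := (continuous_apply c).norm
    exact (isClosed_le hcont continuous_const).mem_of_tendsto hx (Eventually.of_forall fun n => by exact hbox n c)
  -- `T` is continuous along the sequence: `T (u n) → T x`
  have hTlip : ∀ n, ‖T (u n) - T x‖ ≤ q * (‖u n - x‖ / m) * Wm := fun n =>
    fromW (T (u n) - T x) (q * (‖u n - x‖ / m)) (by positivity) fun c => by
      rw [Pi.sub_apply]
      exact hlip (u n) x (hbox n) hxbox (‖u n - x‖ / m) (by positivity) (fun c' => by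
        have h := toW (u n - x) c'
        rwa [Pi.sub_apply] at h) c
  have hux : Tendsto (fun n => ‖u n - x‖) atTop (𝓝 0) := tendsto_iff_norm_sub_tendsto_zero.mp hx
  have hTu : Tendsto (fun n => T (u n)) atTop (𝓝 (T x)) := by
    refine tendsto_iff_norm_sub_tendsto_zero.mpr ?_
    refine squeeze_zero (fun n => norm_nonneg _) hTlip ?_
    have : Tendsto (fun n => q * (‖u n - x‖ / m) * Wm) atTop (𝓝 (q * (0 / m) * Wm)) :=
      ((hux.div_const m).const_mul q).mul_const Wm
    simpa using this
  have hTu' : Tendsto (fun n => T (u n)) atTop (𝓝 x) := by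
    have h := hx.comp (tendsto_add_atTop_nat 1)
    refine h.congr fun n => ?_
    simp only [Function.comp_apply, hu_succ]
  have hTx : T x = x := tendsto_nhds_unique hTu hTu'
  exact ⟨x, hxbox, hTx, huniq x hxbox hTx⟩

end Exists

/-! ## §2 The loop-variable rows from ONE fine-level comparison pushed through Lipschitz chart-level maps -/

section Fine

variable {𝕍 : Type} [NormedAddCommGroup 𝕍] [NormedSpace ℂ 𝕍] {F : T3Family} {γ : ℝ}

/-- The chart-level rate is weaker than the depth rate: `1 + j ≤ K − n`, `1 ≤ L`, `0 ≤ a` ⟹ `(L^{−(K−n)})^a ≤ (L^{−(1+j)})^a`. [cite: King1986, Prop. 3.8 (3.71) p.664] -/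
theorem depthRate_le_levelRate (hL : 1 ≤ F.L) {a : ℝ} (ha : 0 ≤ a) {K n j : ℕ} (hj : j < K - n) :
    (((F.L : ℝ) ^ (K - n))⁻¹) ^ a ≤ (((F.L : ℝ) ^ (1 + j))⁻¹) ^ a := by
  have hLr : (1 : ℝ) ≤ F.L := by exact_mod_cast hL
  have hL0 : (0 : ℝ) < F.L := by linarith
  exact Real.rpow_le_rpow (by positivity) (inv_anti₀ (by positivity) (pow_le_pow_right₀ hLr (by omega))) ha

omit [NormedSpace ℂ 𝕍] in
/-- **(R5) FROM ONE FINE-LEVEL COMPARISON WITH A REFERENCE BACKGROUND.**  Free data: a type family `S K` of run `K`'s fine configurations, run `K`'s fine background `U K k W : S K`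
and a reference fine background `Uref K k W : S K`, the chart-level loop-variable maps `Φ K k j Y : S K → (PBond (F.P K) j → 𝕍)` and a comparison functional `δ K k : S K → S K → ℝ`.
If on run `K`'s window / listed domains (B) `B K (K−n) j Y (V↑) = Φ … (U K (K−n) (V↑))`, (R) `BR K (K−n) j Y (V↑) = Φ … (Uref K (K−n) (V↑))`, (Lip) legwise
`‖Φ(U) c − Φ(Uref) c‖ ≤ L_Φ·(1+d(c))·x²·δ(U, Uref)` and (Fine) `δ(U, Uref) ≤ C_f·θ(n)·(L^{−(K−n)})^a` (the ONE analytic input, rate in the DEPTH `K − n`), then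
`CfgRefOwnΦ D B BR dist b₀ p₀ a (L_Φ·C_f)` (distances nonnegative, window letters for `θ ≥ 0`). [cite: King1986, Prop. 3.8 (3.71) p.664, Prop. 3.9 (3.73)-(3.74) p.665; Balaban1985UV3, (27) p.263, (44) p.267] -/
theorem cfgRefOwnΦ_of_fineComparison {D : AlphaDataT3 F γ} {B BR : CfgFam 𝕍 F} {dist : LegDist F} {b₀ p₀ a L_Φ C_f : ℝ} (S : ℕ → Type)
    (U Uref : (K k : ℕ) → GaugeField (F.P K) k (Matrix.specialUnitaryGroup (Fin 2) ℂ) → S K)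
    (Φ : (K k b : ℕ) → Set (Site (F.P K) 0) → S K → (PBond (F.P K) b → 𝕍)) (δ : (K k : ℕ) → S K → S K → ℝ)
    (hn : DistNonneg dist) (hL : 1 ≤ F.L) (hγ : 0 < γ) (hγ1 : γ ≤ 1) (hb : 0 < b₀) (hLΦ : 0 ≤ L_Φ) (hCf : 0 ≤ C_f) (ha : 0 ≤ a)
    (hB : ∀ (K n : ℕ) (h : n ≤ K), ∀ j : ℕ, j < K - n →
      ∀ V : GaugeField (F.P n) 0 (Matrix.specialUnitaryGroup (Fin 2) ℂ), PlaqSmall (θBal F.L γ b₀ p₀ n) V →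
        ∀ Y ∈ D.Loc K (K - n) (D.triv K (K - n)) (1 + j),
          B K (K - n) j Y (fieldShift (F.sitesPerDir_eq (m := F.m) (K := K) (j := K - n) (m' := F.m) (K' := n) (j' := 0) (by omega)) V) = Φ K (K - n) j Y (U K (K - n) (fieldShift (F.sitesPerDir_eq (m := F.m) (K := K) (j := K - n) (m' := F.m) (K' := n) (j' := 0) (by omega)) V)))
    (hBR : ∀ (K n : ℕ) (h : n ≤ K), ∀ j : ℕ, j < K - n →
      ∀ V : GaugeField (F.P n) 0 (Matrix.specialUnitaryGroup (Fin 2) ℂ), PlaqSmall (θBal F.L γ b₀ p₀ n) V →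
        ∀ Y ∈ D.Loc K (K - n) (D.triv K (K - n)) (1 + j),
          BR K (K - n) j Y (fieldShift (F.sitesPerDir_eq (m := F.m) (K := K) (j := K - n) (m' := F.m) (K' := n) (j' := 0) (by omega)) V) = Φ K (K - n) j Y (Uref K (K - n) (fieldShift (F.sitesPerDir_eq (m := F.m) (K := K) (j := K - n) (m' := F.m) (K' := n) (j' := 0) (by omega)) V)))
    (hLip : ∀ (K n : ℕ) (h : n ≤ K), ∀ j : ℕ, j < K - n →
      ∀ V : GaugeField (F.P n) 0 (Matrix.specialUnitaryGroup (Fin 2) ℂ), PlaqSmall (θBal F.L γ b₀ p₀ n) V →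
        ∀ Y ∈ D.Loc K (K - n) (D.triv K (K - n)) (1 + j), ∀ c : PBond (F.P K) j,
          ‖Φ K (K - n) j Y (U K (K - n) (fieldShift (F.sitesPerDir_eq (m := F.m) (K := K) (j := K - n) (m' := F.m) (K' := n) (j' := 0) (by omega)) V)) c - Φ K (K - n) j Y (Uref K (K - n) (fieldShift (F.sitesPerDir_eq (m := F.m) (K := K) (j := K - n) (m' := F.m) (K' := n) (j' := 0) (by omega)) V)) c‖ ≤
            L_Φ * (1 + dist K j Y c) * (((F.L : ℝ) ^ (K - n - 1 - j))⁻¹) ^ 2 * δ K (K - n) (U K (K - n) (fieldShift (F.sitesPerDir_eq (m := F.m) (K := K) (j := K - n) (m' := F.m) (K' := n) (j' := 0) (by omega)) V)) (Uref K (K - n) (fieldShift (F.sitesPerDir_eq (m := F.m) (K := K) (j := K - n) (m' := F.m) (K' := n) (j' := 0) (by omega)) V)))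
    (hFine : ∀ (K n : ℕ) (h : n ≤ K), ∀ V : GaugeField (F.P n) 0 (Matrix.specialUnitaryGroup (Fin 2) ℂ), PlaqSmall (θBal F.L γ b₀ p₀ n) V →
        δ K (K - n) (U K (K - n) (fieldShift (F.sitesPerDir_eq (m := F.m) (K := K) (j := K - n) (m' := F.m) (K' := n) (j' := 0) (by omega)) V)) (Uref K (K - n) (fieldShift (F.sitesPerDir_eq (m := F.m) (K := K) (j := K - n) (m' := F.m) (K' := n) (j' := 0) (by omega)) V)) ≤ C_f * θBal F.L γ b₀ p₀ n * (((F.L : ℝ) ^ (K - n))⁻¹) ^ a) :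
    CfgRefOwnΦ D B BR dist b₀ p₀ a (L_Φ * C_f) := by
  intro K n hnK j hj V hV Y hY c
  rw [hB K n hnK j hj V hV Y hY, hBR K n hnK j hj V hV Y hY]
  have hθ : 0 ≤ θBal F.L γ b₀ p₀ n := (T3MinimiserStabilityReduction.θBal_pos hL hγ hγ1 hb p₀ n).le
  have hd : 0 ≤ 1 + dist K j Y c := by linarith [hn K j Y c]
  have h0 : 0 ≤ L_Φ * (1 + dist K j Y c) * (((F.L : ℝ) ^ (K - n - 1 - j))⁻¹) ^ 2 := by positivity
  have h1 : 0 ≤ L_Φ * (1 + dist K j Y c) * (((F.L : ℝ) ^ (K - n - 1 - j))⁻¹) ^ 2 * (C_f * θBal F.L γ b₀ p₀ n) := mul_nonneg h0 (mul_nonneg hCf hθ)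
  calc _ ≤ L_Φ * (1 + dist K j Y c) * (((F.L : ℝ) ^ (K - n - 1 - j))⁻¹) ^ 2 * δ K (K - n) (U K (K - n) (fieldShift (F.sitesPerDir_eq (m := F.m) (K := K) (j := K - n) (m' := F.m) (K' := n) (j' := 0) (by omega)) V)) (Uref K (K - n) (fieldShift (F.sitesPerDir_eq (m := F.m) (K := K) (j := K - n) (m' := F.m) (K' := n) (j' := 0) (by omega)) V)) :=
        hLip K n hnK j hj V hV Y hY c
    _ ≤ L_Φ * (1 + dist K j Y c) * (((F.L : ℝ) ^ (K - n - 1 - j))⁻¹) ^ 2 * (C_f * θBal F.L γ b₀ p₀ n * (((F.L : ℝ) ^ (K - n))⁻¹) ^ a) :=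
        mul_le_mul_of_nonneg_left (hFine K n hnK V hV) h0
    _ = L_Φ * (1 + dist K j Y c) * (((F.L : ℝ) ^ (K - n - 1 - j))⁻¹) ^ 2 * (C_f * θBal F.L γ b₀ p₀ n) * (((F.L : ℝ) ^ (K - n))⁻¹) ^ a := by ring
    _ ≤ L_Φ * (1 + dist K j Y c) * (((F.L : ℝ) ^ (K - n - 1 - j))⁻¹) ^ 2 * (C_f * θBal F.L γ b₀ p₀ n) * (((F.L : ℝ) ^ (1 + j))⁻¹) ^ a :=
        mul_le_mul_of_nonneg_left (depthRate_le_levelRate hL ha hj) h1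
    _ = L_Φ * C_f * (1 + dist K j Y c) * θBal F.L γ b₀ p₀ n * (((F.L : ℝ) ^ (K - n - 1 - j))⁻¹) ^ 2 * (((F.L : ℝ) ^ (1 + j))⁻¹) ^ a := by ring

omit [NormedSpace ℂ 𝕍] in
/-- **THE I-11 ROW `CfgDistCauchyΦ` FROM ONE FINE-LEVEL TWO-CUT-OFF COMPARISON, NO REFERENCE OBJECT.**  As `cfgRefOwnΦ_of_fineComparison`, with run `K+1`'s ONCE-AVERAGED fine
background `Ubar K k k′ W′ : S K` (read on run `K`'s fine lattice; `W′` = run `K+1`'s level-`k′` current field, `k′ = k + 1`) in place of the reference: (B) as there; (B′) THE INTERTWINING DISPLAY — run `K+1`'s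
level-`(j+1)` loop variables on the matched bonds ARE run `K`'s level-`j` map at `Ubar` («average `j+1` times = once, then `j` times»; [Balaban1985Averaging] Prop. 2):
`B (K+1) (K+1−n) (j+1) (refineSet Y) (V↑′) (matchBond c) = Φ K (K−n) j Y (Ubar K (K−n) (V↑′)) c`; (Lip) at the pair `(U, Ubar)`; (Fine) `δ(U_K, Ubar_{K+1}) ≤ C_f·θ(n)·(L^{−(K−n)})^a`
— the two-cut-off comparison of the constrained minimisers at the finest level, the ONE analytic input.  Then `CfgDistCauchyΦ D B dist b₀ p₀ a (L_Φ·C_f)`.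
[cite: King1986, Prop. 3.8 (3.71) p.664, Prop. 3.9 (3.73)-(3.74) p.665; Balaban1985UV3, (27) p.263, (44) p.267; Balaban1985Averaging, Prop. 2 p.26] -/
theorem cfgDistCauchyΦ_of_fineComparison {D : AlphaDataT3 F γ} {B : CfgFam 𝕍 F} {dist : LegDist F} {b₀ p₀ a L_Φ C_f : ℝ} (S : ℕ → Type)
    (U : (K k : ℕ) → GaugeField (F.P K) k (Matrix.specialUnitaryGroup (Fin 2) ℂ) → S K)
    (Ubar : (K k k' : ℕ) → GaugeField (F.P (K + 1)) k' (Matrix.specialUnitaryGroup (Fin 2) ℂ) → S K)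
    (Φ : (K k b : ℕ) → Set (Site (F.P K) 0) → S K → (PBond (F.P K) b → 𝕍)) (δ : (K k : ℕ) → S K → S K → ℝ)
    (hn : DistNonneg dist) (hL : 1 ≤ F.L) (hγ : 0 < γ) (hγ1 : γ ≤ 1) (hb : 0 < b₀) (hLΦ : 0 ≤ L_Φ) (hCf : 0 ≤ C_f) (ha : 0 ≤ a)
    (hB : ∀ (K n : ℕ) (h : n ≤ K), ∀ j : ℕ, j < K - n →
      ∀ V : GaugeField (F.P n) 0 (Matrix.specialUnitaryGroup (Fin 2) ℂ), PlaqSmall (θBal F.L γ b₀ p₀ n) V →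
        ∀ Y ∈ D.Loc K (K - n) (D.triv K (K - n)) (1 + j),
          B K (K - n) j Y (fieldShift (F.sitesPerDir_eq (m := F.m) (K := K) (j := K - n) (m' := F.m) (K' := n) (j' := 0) (by omega)) V) = Φ K (K - n) j Y (U K (K - n) (fieldShift (F.sitesPerDir_eq (m := F.m) (K := K) (j := K - n) (m' := F.m) (K' := n) (j' := 0) (by omega)) V)))
    (hB' : ∀ (K n : ℕ) (h : n ≤ K), ∀ j : ℕ, j < K - n →
      ∀ V : GaugeField (F.P n) 0 (Matrix.specialUnitaryGroup (Fin 2) ℂ), PlaqSmall (θBal F.L γ b₀ p₀ n) V →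
        ∀ Y ∈ D.Loc K (K - n) (D.triv K (K - n)) (1 + j), ∀ c : PBond (F.P K) j,
          B (K + 1) (K + 1 - n) (j + 1) (refineSet F K Y) (fieldShift (F.sitesPerDir_eq (m := F.m) (K := K + 1) (j := K + 1 - n) (m' := F.m) (K' := n) (j' := 0) (by omega)) V) (matchBond F K j c) =
            Φ K (K - n) j Y (Ubar K (K - n) (K + 1 - n) (fieldShift (F.sitesPerDir_eq (m := F.m) (K := K + 1) (j := K + 1 - n) (m' := F.m) (K' := n) (j' := 0) (by omega)) V)) c)
    (hLip : ∀ (K n : ℕ) (h : n ≤ K), ∀ j : ℕ, j < K - n →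
      ∀ V : GaugeField (F.P n) 0 (Matrix.specialUnitaryGroup (Fin 2) ℂ), PlaqSmall (θBal F.L γ b₀ p₀ n) V →
        ∀ Y ∈ D.Loc K (K - n) (D.triv K (K - n)) (1 + j), ∀ c : PBond (F.P K) j,
          ‖Φ K (K - n) j Y (U K (K - n) (fieldShift (F.sitesPerDir_eq (m := F.m) (K := K) (j := K - n) (m' := F.m) (K' := n) (j' := 0) (by omega)) V)) c - Φ K (K - n) j Y (Ubar K (K - n) (K + 1 - n) (fieldShift (F.sitesPerDir_eq (m := F.m) (K := K + 1) (j := K + 1 - n) (m' := F.m) (K' := n) (j' := 0) (by omega)) V)) c‖ ≤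
            L_Φ * (1 + dist K j Y c) * (((F.L : ℝ) ^ (K - n - 1 - j))⁻¹) ^ 2 *
              δ K (K - n) (U K (K - n) (fieldShift (F.sitesPerDir_eq (m := F.m) (K := K) (j := K - n) (m' := F.m) (K' := n) (j' := 0) (by omega)) V)) (Ubar K (K - n) (K + 1 - n) (fieldShift (F.sitesPerDir_eq (m := F.m) (K := K + 1) (j := K + 1 - n) (m' := F.m) (K' := n) (j' := 0) (by omega)) V)))
    (hFine : ∀ (K n : ℕ) (h : n ≤ K), 0 < K - n → ∀ V : GaugeField (F.P n) 0 (Matrix.specialUnitaryGroup (Fin 2) ℂ), PlaqSmall (θBal F.L γ b₀ p₀ n) V →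
        δ K (K - n) (U K (K - n) (fieldShift (F.sitesPerDir_eq (m := F.m) (K := K) (j := K - n) (m' := F.m) (K' := n) (j' := 0) (by omega)) V)) (Ubar K (K - n) (K + 1 - n) (fieldShift (F.sitesPerDir_eq (m := F.m) (K := K + 1) (j := K + 1 - n) (m' := F.m) (K' := n) (j' := 0) (by omega)) V)) ≤
          C_f * θBal F.L γ b₀ p₀ n * (((F.L : ℝ) ^ (K - n))⁻¹) ^ a) :
    CfgDistCauchyΦ D B dist b₀ p₀ a (L_Φ * C_f) := by
  intro K n hnK j hj V hV Y hY c
  rw [hB K n hnK j hj V hV Y hY, hB' K n hnK j hj V hV Y hY c, norm_sub_rev]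
  have hθ : 0 ≤ θBal F.L γ b₀ p₀ n := (T3MinimiserStabilityReduction.θBal_pos hL hγ hγ1 hb p₀ n).le
  have hd : 0 ≤ 1 + dist K j Y c := by linarith [hn K j Y c]
  have h0 : 0 ≤ L_Φ * (1 + dist K j Y c) * (((F.L : ℝ) ^ (K - n - 1 - j))⁻¹) ^ 2 := by positivity
  have h1 : 0 ≤ L_Φ * (1 + dist K j Y c) * (((F.L : ℝ) ^ (K - n - 1 - j))⁻¹) ^ 2 * (C_f * θBal F.L γ b₀ p₀ n) := mul_nonneg h0 (mul_nonneg hCf hθ)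
  calc _ ≤ L_Φ * (1 + dist K j Y c) * (((F.L : ℝ) ^ (K - n - 1 - j))⁻¹) ^ 2 * _ := hLip K n hnK j hj V hV Y hY c
    _ ≤ L_Φ * (1 + dist K j Y c) * (((F.L : ℝ) ^ (K - n - 1 - j))⁻¹) ^ 2 * (C_f * θBal F.L γ b₀ p₀ n * (((F.L : ℝ) ^ (K - n))⁻¹) ^ a) :=
        mul_le_mul_of_nonneg_left (hFine K n hnK (by omega) V hV) h0
    _ = L_Φ * (1 + dist K j Y c) * (((F.L : ℝ) ^ (K - n - 1 - j))⁻¹) ^ 2 * (C_f * θBal F.L γ b₀ p₀ n) * (((F.L : ℝ) ^ (K - n))⁻¹) ^ a := by ring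
    _ ≤ L_Φ * (1 + dist K j Y c) * (((F.L : ℝ) ^ (K - n - 1 - j))⁻¹) ^ 2 * (C_f * θBal F.L γ b₀ p₀ n) * (((F.L : ℝ) ^ (1 + j))⁻¹) ^ a :=
        mul_le_mul_of_nonneg_left (depthRate_le_levelRate hL ha hj) h1
    _ = L_Φ * C_f * (1 + dist K j Y c) * θBal F.L γ b₀ p₀ n * (((F.L : ℝ) ^ (K - n - 1 - j))⁻¹) ^ 2 * (((F.L : ℝ) ^ (1 + j))⁻¹) ^ a := by ring

end Fine

end Summit.QuantumFields.YangMills.Theorems.GlobalSlackKernelLeg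

end
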